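import Mathlib.RingTheory.Valuation.ValuationSubring
import Mathlib.RingTheory.Algebraic.Basic
import Mathlib.Algebra.Ring.GeomSum
import Mathlib.Algebra.CharP.Basic
import Mathlib.GroupTheory.OrderOfElement
import HarnessLib

/-!
# Finitely many pairwise incomparable valuation rings: approximation, and incomparability of the extensions of a valuation to an algebraic extension

Topic: `Literature/AlgebraicGeometry/Resolution` (valuation theory serving the valued-function-field
facts of this topic; first file of the proof of the named fact `KuhlmannNovacoski2014_Thm12`,
`Kuhlmann2019HenselianRationality.lean`, kept in the prover's notes). Two classical results that
Mathlib lacks: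

* `ValuationSubring.exists_crt_of_forall_le_imp_eq` — **weak approximation for finitely many
  pairwise incomparable valuation rings** `R₁, …, Rₙ` of a field `K` (Nagata; Matsumura,
  *Commutative Ring Theory*, Thm. 12.2, in the form of the Chinese remainder property of
  `A = ⋂ Rᵢ`): for each `j` there is `e ∈ ⋂ᵢ Rᵢ` with `e ≡ 1 (mod 𝔪ⱼ)` and `e ≡ 0 (mod 𝔪ᵢ)` for
  `i ≠ j`. The proof is Nagata's: for `y ∈ K` and a suitable exponent `e ≥ 2` the geometric sum
  `u = 1 + y + ⋯ + y^{e-1}` is a unit of every `Rᵢ` containing `y`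
  (`ValuationSubring.exists_geom_sum_valuation_eq_one`, the exponent being chosen `≡ 1` modulo
  the residue characteristics and the multiplicative orders of the residues of `y`), while
  `vᵢ(u) = vᵢ(y)^{e-1} > 1` when `y ∉ Rᵢ`; so `u⁻¹ ∈ ⋂ Rᵢ` separates `Rⱼ ∋ y` from `Rᵢ ∌ y`,
  and products and a normalisation give the idempotent-like elements.
* `ValuationSubring.eq_of_le_of_comap_eq` — **the extensions of a valuation ring `O` of `F` to an
  algebraic extension `E` are pairwise incomparable**: `W ≤ W'` with `W ∩ F = W' ∩ F` forces
  `W = W'` (Bourbaki, *Alg. comm.* VI §8 no. 3; Zariski–Samuel II, VI §7). Proof: for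
  `x ∈ W' ∖ W` take an equation `∑ bₖ xᵏ = 0` over `O` with some `bₖ` a unit and let `j` be the
  largest such index; every other term has `W`-value `< v_W(x)ʲ` (for `k < j` because
  `v_W(x) > 1`, for `k > j` because `bₖ ∈ 𝔪_O ⊆ 𝔪_{W'} ⊆ 𝔪_W` and `x ∈ W'`), contradiction.

All statements [folklore] (textbook valuation theory); the file defines nothing.
-/

noncomputable section

open scoped Pointwise
open Finset

namespace Literature.AlgebraicGeometry.Resolution

namespace ValuationSubring

variable {K : Type*} [Field K]

/-! ## Units and non-units of a valuation ring, valuatively -/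

/-- `v(u - 1) < 1 ⇒ v(u) = 1`. [folklore] -/
theorem valuation_eq_one_of_sub_one (A : _root_.ValuationSubring K) {u : K}
    (h : A.valuation (u - 1) < 1) : A.valuation u = 1 := by
  have : u = 1 + (u - 1) := by ring
  rw [this]
  exact A.valuation.map_one_add_of_lt h

/-- A product over a finset of elements of value `≤ 1`, one of which has value `< 1`, has value
`< 1`. [folklore] -/
theorem valuation_prod_lt_one (A : _root_.ValuationSubring K) {ι : Type*} (s : Finset ι)
    (f : ι → K) (hle : ∀ i ∈ s, A.valuation (f i) ≤ 1) {i₀ : ι} (hi₀ : i₀ ∈ s)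
    (hlt : A.valuation (f i₀) < 1) : A.valuation (∏ i ∈ s, f i) < 1 := by
  classical
  rw [← Finset.mul_prod_erase s f hi₀, map_mul, map_prod]
  calc A.valuation (f i₀) * ∏ i ∈ s.erase i₀, A.valuation (f i)
      ≤ A.valuation (f i₀) * 1 := by
        gcongr
        exact Finset.prod_le_one' fun i hi => hle i (Finset.mem_of_mem_erase hi)
    _ < 1 := by rw [mul_one]; exact hlt

/-- A product of elements of value `1` has value `1`. [folklore] -/
theorem valuation_prod_eq_one (A : _root_.ValuationSubring K) {ι : Type*} (s : Finset ι)
    (f : ι → K) (h : ∀ i ∈ s, A.valuation (f i) = 1) : A.valuation (∏ i ∈ s, f i) = 1 := by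
  rw [map_prod]
  exact Finset.prod_eq_one h

/-! ## Geometric sums in a valuation ring -/

/-- If `v(y) < 1` then `1 + y + ⋯ + y^{e-1}` is a unit (`e ≥ 1`). [folklore] -/
theorem valuation_geom_sum_of_lt_one (A : _root_.ValuationSubring K) {y : K}
    (hy : A.valuation y < 1) {e : ℕ} (he : 1 ≤ e) :
    A.valuation (∑ k ∈ range e, y ^ k) = 1 := by
  obtain ⟨n, rfl⟩ := Nat.exists_eq_add_of_le' he
  rw [geom_sum_succ, add_comm]
  refine A.valuation.map_one_add_of_lt ?_
  rw [map_mul]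
  have hs : A.valuation (∑ k ∈ range n, y ^ k) ≤ 1 := by
    refine A.valuation.map_sum_le fun k _ => ?_
    rw [map_pow]
    exact pow_le_one' hy.le _
  calc A.valuation y * A.valuation (∑ k ∈ range n, y ^ k) ≤ A.valuation y * 1 := by gcongr
    _ < 1 := by rwa [mul_one]

/-- If `v(y) > 1` then `v(1 + y + ⋯ + y^{e-1}) = v(y)^{e-1}` (`e ≥ 1`). [folklore] -/
theorem valuation_geom_sum_of_one_lt (A : _root_.ValuationSubring K) {y : K}
    (hy : 1 < A.valuation y) (n : ℕ) :
    A.valuation (∑ k ∈ range (n + 1), y ^ k) = A.valuation y ^ n := by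
  induction n with
  | zero => simp
  | succ n ih =>
    rw [geom_sum_succ', A.valuation.map_add_eq_of_lt_left, map_pow]
    rw [ih, map_pow]
    exact pow_lt_pow_right₀ hy n.lt_succ_self

/-- For a unit `y` of `A`, `1 + y + ⋯ + y^{e-1}` is a unit of `A` unless its residue vanishes,
and the residue vanishes only if `d ∣ e` for some `d ≠ 1` depending on `y` alone (the residue
characteristic if `ȳ = 1`, the multiplicative order of `ȳ` otherwise). [folklore] -/
theorem exists_dvd_of_geom_sum_nonunit (A : _root_.ValuationSubring K) {y : K}
    (hy : A.valuation y = 1) :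
    ∃ d : ℕ, d ≠ 1 ∧ ∀ e : ℕ, A.valuation (∑ k ∈ range e, y ^ k) ≠ 1 → d ∣ e := by
  classical
  have hyA : y ∈ A := (A.valuation_le_one_iff y).mp hy.le
  set a : A := ⟨y, hyA⟩ with ha
  set abar := IsLocalRing.residue A a with habar
  -- the geometric sum is the image of the geometric sum of `a`
  have hsum : ∀ e : ℕ, (∑ k ∈ range e, y ^ k) = ((∑ k ∈ range e, a ^ k : A) : K) := by
    intro e
    simp [ha]
  -- non-unit ⇔ residue of the sum vanishes
  have hcrit : ∀ e : ℕ, A.valuation (∑ k ∈ range e, y ^ k) ≠ 1 →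
      (∑ k ∈ range e, abar ^ k) = 0 := by
    intro e he
    rw [hsum e] at he
    have hnu : ¬ IsUnit (∑ k ∈ range e, a ^ k : A) := fun hu =>
      he ((A.valuation_eq_one_iff _).mp hu)
    have hmem : (∑ k ∈ range e, a ^ k : A) ∈ IsLocalRing.maximalIdeal A :=
      (IsLocalRing.mem_maximalIdeal _).mpr hnu
    have := (IsLocalRing.residue_eq_zero_iff _).mpr hmem
    simpa [habar, map_sum, map_pow] using this
  by_cases h1 : abar = 1
  · -- `ȳ = 1`: the sum is `e`, which vanishes iff the residue characteristic divides `e`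
    refine ⟨ringChar (IsLocalRing.ResidueField A), CharP.ringChar_ne_one, fun e he => ?_⟩
    have h0 := hcrit e he
    rw [h1, one_geom_sum] at h0
    exact (ringChar.spec _ e).mp h0
  · -- `ȳ ≠ 1`: the sum vanishes only if `ȳ ^ e = 1`, i.e. `orderOf ȳ ∣ e`
    refine ⟨orderOf abar, fun h => h1 (orderOf_eq_one_iff.mp h), fun e he => ?_⟩
    have h0 := hcrit e he
    have hpow : abar ^ e = 1 := by
      have h2 := geom_sum_mul abar e
      rw [h0, zero_mul] at h2
      exact sub_eq_zero.mp h2.symm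
    exact orderOf_dvd_of_pow_eq_one hpow

/-! ## Nagata's exponent and the separating elements -/

/-- **Nagata's exponent**: for `y ∈ K` and finitely many valuation rings `Rᵢ` there is `e ≥ 2`
such that `1 + y + ⋯ + y^{e-1}` is a unit of every `Rᵢ` containing `y` (choose
`e ≡ 1` modulo every modulus of `exists_dvd_of_geom_sum_nonunit`). [folklore] -/
theorem exists_geom_sum_valuation_eq_one {ι : Type*} [Finite ι]
    (R : ι → _root_.ValuationSubring K) (y : K) :
    ∃ e : ℕ, 2 ≤ e ∧ ∀ i, y ∈ R i → (R i).valuation (∑ k ∈ range e, y ^ k) = 1 := by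
  classical
  haveI := Fintype.ofFinite ι
  have hd : ∀ i, ∃ d : ℕ, d ≠ 1 ∧ ((R i).valuation y = 1 →
      ∀ e : ℕ, (R i).valuation (∑ k ∈ range e, y ^ k) ≠ 1 → d ∣ e) := by
    intro i
    by_cases hy : (R i).valuation y = 1
    · obtain ⟨d, hd1, hd⟩ := exists_dvd_of_geom_sum_nonunit (R i) hy
      exact ⟨d, hd1, fun _ => hd⟩
    · exact ⟨0, zero_ne_one, fun h => absurd h hy⟩
  choose d hd1 hd using hd
  set N : ℕ := ∏ i, max (d i) 1 with hN
  have hNpos : 0 < N := Finset.prod_pos fun i _ => lt_of_lt_of_le one_pos (le_max_right _ _)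
  refine ⟨1 + 2 * N, by omega, fun i hyi => ?_⟩
  rcases (((R i).valuation_le_one_iff y).mpr hyi).lt_or_eq with hlt | heq
  · exact valuation_geom_sum_of_lt_one (R i) hlt (by omega)
  · by_contra hne
    have hdvd : d i ∣ 1 + 2 * N := hd i heq _ hne
    rcases Nat.eq_zero_or_pos (d i) with h0 | hpos
    · rw [h0, zero_dvd_iff] at hdvd
      omega
    · have hdN : d i ∣ N := by
        have hmax : max (d i) 1 = d i := max_eq_left hpos
        rw [hN, ← hmax]
        exact Finset.dvd_prod_of_mem (fun i => max (d i) 1) (Finset.mem_univ i)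
      have h2N : d i ∣ 2 * N := Dvd.dvd.mul_left hdN 2
      rw [add_comm] at hdvd
      exact hd1 i (Nat.dvd_one.mp ((Nat.dvd_add_right h2N).mp hdvd))

/-- **Separating element**: if `Rⱼ ⊄ Rᵢ` there is `s ∈ ⋂ₖ Rₖ` which is a unit of `Rⱼ` and a
non-unit of `Rᵢ` (namely `s = u⁻¹` for `u = 1 + y + ⋯ + y^{e-1}`, `y ∈ Rⱼ ∖ Rᵢ`, `e` Nagata's
exponent). [folklore] -/
theorem exists_forall_mem_valuation_lt_one_eq_one {ι : Type*} [Finite ι]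
    (R : ι → _root_.ValuationSubring K) {i j : ι} (hij : ¬ R j ≤ R i) :
    ∃ s : K, (∀ k, s ∈ R k) ∧ (R i).valuation s < 1 ∧ (R j).valuation s = 1 := by
  obtain ⟨y, hyj, hyi⟩ := SetLike.not_le_iff_exists.mp hij
  obtain ⟨e, he2, he⟩ := exists_geom_sum_valuation_eq_one R y
  set u := ∑ k ∈ range e, y ^ k with hu_def
  have hu : ∀ k, y ∉ R k → 1 < (R k).valuation u := by
    intro k hk
    have hy1 : 1 < (R k).valuation y := by
      rw [← not_le, (R k).valuation_le_one_iff]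
      exact hk
    obtain ⟨n, hn⟩ := Nat.exists_eq_add_of_le' (by omega : 1 ≤ e)
    rw [hu_def, hn, valuation_geom_sum_of_one_lt (R k) hy1 n]
    exact one_lt_pow₀ hy1 (by omega)
  refine ⟨u⁻¹, fun k => ?_, ?_, ?_⟩
  · rw [← (R k).valuation_le_one_iff, map_inv₀]
    by_cases hk : y ∈ R k
    · rw [he k hk, inv_one]
    · exact inv_le_one_of_one_le₀ (hu k hk).le
  · rw [map_inv₀]
    exact inv_lt_one_of_one_lt₀ (hu i hyi)
  · rw [map_inv₀, he j hyj, inv_one]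

/-! ## Weak approximation (Chinese remainder) for pairwise incomparable valuation rings -/

/-- **Weak approximation for finitely many pairwise incomparable valuation rings** (Nagata;
Matsumura, *Commutative Ring Theory*, Thm. 12.2): if `Rᵢ ≤ Rⱼ` only for `i = j`, then for
every `j` there is `e ∈ ⋂ᵢ Rᵢ` with `e ≡ 1 (mod 𝔪_{Rⱼ})` and `e ∈ 𝔪_{Rᵢ}` for all `i ≠ j`.
[folklore] -/
theorem exists_crt_of_forall_le_imp_eq {ι : Type*} [Finite ι]
    (R : ι → _root_.ValuationSubring K) (hR : ∀ i j, R i ≤ R j → i = j) (j : ι) :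
    ∃ e : K, (∀ i, e ∈ R i) ∧ (R j).valuation (e - 1) < 1 ∧
      ∀ i, i ≠ j → (R i).valuation e < 1 := by
  classical
  haveI := Fintype.ofFinite ι
  -- `t j ∈ ⋂ Rₖ`, a unit of `R j`, a non-unit of every other `R i`
  have ht : ∀ j, ∃ t : K, (∀ k, t ∈ R k) ∧ (R j).valuation t = 1 ∧
      ∀ i, i ≠ j → (R i).valuation t < 1 := by
    intro j
    have hs : ∀ i, ∃ s : K, i ≠ j →
        (∀ k, s ∈ R k) ∧ (R i).valuation s < 1 ∧ (R j).valuation s = 1 := by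
      intro i
      by_cases hij : i = j
      · exact ⟨1, fun h => absurd hij h⟩
      · obtain ⟨s, hs⟩ := exists_forall_mem_valuation_lt_one_eq_one R
          (i := i) (j := j) fun h => hij (hR j i h).symm
        exact ⟨s, fun _ => hs⟩
    choose s hs using hs
    refine ⟨∏ i ∈ univ.erase j, s i, fun k => ?_, ?_, fun i hij => ?_⟩
    · exact prod_mem fun i hi => (hs i (ne_of_mem_erase hi)).1 k
    · exact valuation_prod_eq_one (R j) _ _ fun i hi => (hs i (ne_of_mem_erase hi)).2.2
    · refine valuation_prod_lt_one (R i) _ _ (fun i' hi' => ?_)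
        (mem_erase.mpr ⟨hij, mem_univ i⟩) (hs i hij).2.1
      exact ((R i).valuation_le_one_iff _).mpr ((hs i' (ne_of_mem_erase hi')).1 i)
  choose t htmem htone htlt using ht
  set T : K := ∑ i, t i with hT
  have hTsub : ∀ i, (R i).valuation (T - t i) < 1 := by
    intro i
    have : T - t i = ∑ k ∈ univ.erase i, t k := by
      rw [hT, ← Finset.sum_erase_add _ _ (mem_univ i)]
      ring
    rw [this]
    exact (R i).valuation.map_sum_lt one_ne_zero fun k hk => htlt k i (ne_of_mem_erase hk).symm
  have hTone : ∀ i, (R i).valuation T = 1 := by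
    intro i
    have : T = t i + (T - t i) := by ring
    rw [this, (R i).valuation.map_add_eq_of_lt_left ((htone i).symm ▸ hTsub i), htone i]
  refine ⟨t j * T⁻¹, fun i => ?_, ?_, fun i hij => ?_⟩
  · rw [← (R i).valuation_le_one_iff, map_mul, map_inv₀, hTone i, inv_one, mul_one]
    exact ((R i).valuation_le_one_iff _).mpr (htmem j i)
  · have hT0 : T ≠ 0 := fun h => by
      have := hTone j
      rw [h, map_zero] at this
      exact zero_ne_one this
    have : t j * T⁻¹ - 1 = (t j - T) * T⁻¹ := by field_simp
    rw [this, map_mul, map_inv₀, hTone j, inv_one, mul_one, Valuation.map_sub_swap]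
    exact hTsub j
  · rw [map_mul, map_inv₀, hTone i, inv_one, mul_one]
    exact htlt j i hij

/-! ## Extensions of a valuation ring to an algebraic extension are incomparable -/

section Algebraic

variable {F E : Type*} [Field F] [Field E] [Algebra F E]

/-- `b ∈ W ∩ F` iff `b ∈ F` maps into `W`. [folklore] -/
theorem algebraMap_mem_iff (W : _root_.ValuationSubring E) (b : F) :
    algebraMap F E b ∈ W ↔ b ∈ W.comap (algebraMap F E) := Iff.rfl

/-- Restriction is compatible with units: an element of `F` which is a unit of `W ∩ F` is a
unit of `W`. [folklore] -/
theorem valuation_algebraMap_eq_one (W : _root_.ValuationSubring E) {b : F}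
    (hb : (W.comap (algebraMap F E)).valuation b = 1) : W.valuation (algebraMap F E b) = 1 := by
  have hbO : b ∈ W.comap (algebraMap F E) := ((W.comap _).valuation_le_one_iff b).mp hb.le
  have hb0 : b ≠ 0 := by
    rintro rfl
    rw [map_zero] at hb
    exact zero_ne_one hb
  have hbinv : b⁻¹ ∈ W.comap (algebraMap F E) := by
    rw [← (W.comap _).valuation_le_one_iff, map_inv₀, hb, inv_one]
  have hle1 : W.valuation (algebraMap F E b) ≤ 1 := (W.valuation_le_one_iff _).mpr hbO
  have hle2 : W.valuation (algebraMap F E b⁻¹) ≤ 1 := (W.valuation_le_one_iff _).mpr hbinv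
  have h1 : W.valuation (algebraMap F E b) * W.valuation (algebraMap F E b⁻¹) = 1 := by
    rw [← map_mul, ← map_mul, mul_inv_cancel₀ hb0, map_one, map_one]
  refine le_antisymm hle1 ?_
  calc (1 : W.ValueGroup) = W.valuation (algebraMap F E b) * W.valuation (algebraMap F E b⁻¹) :=
      h1.symm
    _ ≤ W.valuation (algebraMap F E b) * 1 := by gcongr
    _ = W.valuation (algebraMap F E b) := mul_one _

/-- Restriction is compatible with non-units: an element of `F` which is a non-unit of
`W ∩ F` is a non-unit of `W`. [folklore] -/
theorem valuation_algebraMap_lt_one (W : _root_.ValuationSubring E) {b : F}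
    (hb : (W.comap (algebraMap F E)).valuation b < 1) : W.valuation (algebraMap F E b) < 1 := by
  by_cases hb0 : b = 0
  · rw [hb0, map_zero, map_zero]
    exact zero_lt_one
  have hbO : b ∈ W.comap (algebraMap F E) := ((W.comap _).valuation_le_one_iff b).mp hb.le
  refine lt_of_le_of_ne ((W.valuation_le_one_iff _).mpr hbO) fun h1 => ?_
  -- if `b` were a unit of `W`, then `b⁻¹ ∈ W ∩ F`, so `b` is a unit of `W ∩ F`
  have hbinv : b⁻¹ ∈ W.comap (algebraMap F E) := by
    rw [← algebraMap_mem_iff, ← W.valuation_le_one_iff, map_inv₀, map_inv₀, h1, inv_one]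
  have : (W.comap (algebraMap F E)).valuation b = 1 := by
    refine le_antisymm hb.le ?_
    have h2 : (W.comap (algebraMap F E)).valuation b⁻¹ ≤ 1 :=
      ((W.comap _).valuation_le_one_iff _).mpr hbinv
    have h3 : (W.comap (algebraMap F E)).valuation b *
        (W.comap (algebraMap F E)).valuation b⁻¹ = 1 := by
      rw [← map_mul, mul_inv_cancel₀ hb0, map_one]
    calc (1 : (W.comap (algebraMap F E)).ValueGroup) = _ * _ := h3.symm
      _ ≤ (W.comap (algebraMap F E)).valuation b * 1 := by gcongr
      _ = _ := mul_one _
  exact hb.ne this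

/-- **The extensions of a valuation ring to an algebraic extension are pairwise incomparable**
(Bourbaki, *Alg. comm.* VI §8 no. 3, Prop. 2 Cor.; Zariski–Samuel II, VI §7): valuation rings
`W ≤ W'` of `E ⊇ F`, `E|F` algebraic, with `W ∩ F = W' ∩ F` coincide. [folklore] -/
theorem eq_of_le_of_comap_eq [Algebra.IsAlgebraic F E] {W W' : _root_.ValuationSubring E}
    (hle : W ≤ W') (hO : W.comap (algebraMap F E) = W'.comap (algebraMap F E)) : W = W' := by
  classical
  refine le_antisymm hle fun x hxW' => ?_
  by_contra hxW
  set O := W'.comap (algebraMap F E) with hOdef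
  have hx0 : x ≠ 0 := by
    rintro rfl
    exact hxW W.zero_mem
  have hvx : 1 < W.valuation x := by
    rw [← not_le, W.valuation_le_one_iff]
    exact hxW
  -- an algebraic relation, normalised so that all coefficients lie in `O` and one is `1`
  obtain ⟨p, hp0, hpx⟩ := Algebra.IsAlgebraic.isAlgebraic (R := F) x
  obtain ⟨k₀, hk₀, hmax⟩ := Finset.exists_max_image p.support (fun k => O.valuation (p.coeff k))
    (Polynomial.support_nonempty.mpr hp0)
  have ha0 : p.coeff k₀ ≠ 0 := Polynomial.mem_support_iff.mp hk₀
  set b : ℕ → F := fun k => p.coeff k / p.coeff k₀ with hb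
  have hbO : ∀ k ∈ p.support, b k ∈ O := fun k hk => by
    rw [← O.valuation_le_one_iff, hb]
    dsimp only
    rw [map_div₀]
    exact div_le_one_of_le₀ (hmax k hk) zero_le
  have hbk₀ : b k₀ = 1 := div_self ha0
  have hsum : ∑ k ∈ p.support, algebraMap F E (b k) * x ^ k = 0 := by
    have h := hpx
    rw [Polynomial.aeval_def, Polynomial.eval₂_eq_sum, Polynomial.sum_def] at h
    have : ∑ k ∈ p.support, algebraMap F E (b k) * x ^ k =
        algebraMap F E (p.coeff k₀)⁻¹ * ∑ k ∈ p.support, algebraMap F E (p.coeff k) * x ^ k := by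
      rw [Finset.mul_sum]
      refine Finset.sum_congr rfl fun k _ => ?_
      rw [hb]
      dsimp only
      rw [div_eq_inv_mul, map_mul, map_inv₀, mul_assoc]
    rw [this, h, mul_zero]
  -- `j`: the largest index whose coefficient is a unit of `O`
  obtain ⟨j, hj, hjmax⟩ := Finset.exists_max_image
    (p.support.filter fun k => O.valuation (b k) = 1) id
    ⟨k₀, Finset.mem_filter.mpr ⟨hk₀, by rw [hbk₀, map_one]⟩⟩
  obtain ⟨hjsupp, hjunit⟩ := Finset.mem_filter.mp hj
  -- valuations of the terms with respect to `W`
  set c : ℕ → E := fun k => algebraMap F E (b k) * x ^ k with hc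
  have hcj : W.valuation (c j) = W.valuation x ^ j := by
    rw [hc]
    dsimp only
    rw [map_mul, map_pow, valuation_algebraMap_eq_one W (hO ▸ hjunit), one_mul]
  have hlt : ∀ k ∈ p.support.erase j, W.valuation (c k) < W.valuation x ^ j := by
    intro k hk
    obtain ⟨hkj, hksupp⟩ := Finset.mem_erase.mp hk
    rcases lt_or_gt_of_ne hkj with hkj | hkj
    · -- `k < j`: `v(bₖ xᵏ) ≤ v(x)ᵏ < v(x)ʲ`
      rw [hc]
      dsimp only
      rw [map_mul, map_pow]
      have hbk : W.valuation (algebraMap F E (b k)) ≤ 1 :=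
        (W.valuation_le_one_iff _).mpr ((algebraMap_mem_iff W _).mpr (hO ▸ hbO k hksupp))
      calc W.valuation (algebraMap F E (b k)) * W.valuation x ^ k ≤ 1 * W.valuation x ^ k := by
            gcongr
        _ = W.valuation x ^ k := one_mul _
        _ < W.valuation x ^ j := pow_lt_pow_right₀ hvx hkj
    · -- `k > j`: `bₖ` is a non-unit of `O`, hence of `W'`, and `bₖ x^{k-j} ∈ 𝔪_{W'} ⊆ 𝔪_W`
      have hbk1 : O.valuation (b k) < 1 := by
        refine lt_of_le_of_ne ((O.valuation_le_one_iff _).mpr (hbO k hksupp)) fun h1 => ?_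
        have : k ≤ j := hjmax k (Finset.mem_filter.mpr ⟨hksupp, h1⟩)
        omega
      have hW' : W'.valuation (algebraMap F E (b k) * x ^ (k - j)) < 1 := by
        rw [map_mul, map_pow]
        have h1 : W'.valuation (algebraMap F E (b k)) < 1 := valuation_algebraMap_lt_one W' hbk1
        have h2 : W'.valuation x ^ (k - j) ≤ 1 :=
          pow_le_one' ((W'.valuation_le_one_iff x).mpr hxW') _
        calc W'.valuation (algebraMap F E (b k)) * W'.valuation x ^ (k - j)
            ≤ W'.valuation (algebraMap F E (b k)) * 1 := by gcongr
          _ < 1 := by rwa [mul_one]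
      have hW : W.valuation (algebraMap F E (b k) * x ^ (k - j)) < 1 := by
        rw [← _root_.ValuationSubring.mem_nonunits_iff] at hW' ⊢
        exact (_root_.ValuationSubring.nonunits_le_nonunits.mpr hle) hW'
      have hck : c k = (algebraMap F E (b k) * x ^ (k - j)) * x ^ j := by
        rw [hc]
        dsimp only
        rw [mul_assoc, ← pow_add, Nat.sub_add_cancel hkj.le]
      rw [hck, map_mul, map_pow]
      calc W.valuation (algebraMap F E (b k) * x ^ (k - j)) * W.valuation x ^ j
          < 1 * W.valuation x ^ j := by
            gcongr
            exact pow_ne_zero _ ((map_ne_zero _).mpr hx0) |>.bot_lt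
        _ = W.valuation x ^ j := one_mul _
  -- the sum has value `v(x)ʲ ≠ 0`, but it vanishes
  have hsplit : ∑ k ∈ p.support, c k = c j + ∑ k ∈ p.support.erase j, c k :=
    (Finset.add_sum_erase _ _ hjsupp).symm
  have hrest : W.valuation (∑ k ∈ p.support.erase j, c k) < W.valuation x ^ j :=
    W.valuation.map_sum_lt (pow_ne_zero _ ((map_ne_zero _).mpr hx0)) hlt
  have hval : W.valuation (∑ k ∈ p.support, c k) = W.valuation x ^ j := by
    rw [hsplit, W.valuation.map_add_eq_of_lt_left (hcj.symm ▸ hrest), hcj]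
  rw [show (∑ k ∈ p.support, c k) = 0 from hsum, map_zero] at hval
  exact pow_ne_zero _ ((map_ne_zero _).mpr hx0) hval.symm

/-- **Incomparability**, symmetric form: two distinct valuation rings of an algebraic extension
`E ⊇ F` lying over the same valuation ring of `F` are incomparable. [folklore] -/
theorem not_le_of_ne_of_comap_eq [Algebra.IsAlgebraic F E] {W W' : _root_.ValuationSubring E}
    (hne : W ≠ W') (hO : W.comap (algebraMap F E) = W'.comap (algebraMap F E)) : ¬ W ≤ W' :=
  fun hle => hne (eq_of_le_of_comap_eq hle hO)

end Algebraic

end ValuationSubring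

end Literature.AlgebraicGeometry.Resolution

end
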